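/-
Copyright (c) 2026 H21 harness. All rights reserved.
Released under Apache 2.0 license as described in the file LICENSE.
-/
import Mathlib
import Summits.ResolutionOfSingularities.ResolutionOfSingularities.Theorems.FrobeniusClosingSteerDerivationNilpotent
import Summits.ResolutionOfSingularities.ResolutionOfSingularities.Theorems.FrobeniusClosingSteerSingularTraceSandwich

/-!
# Frobenius-closing steer — derivation criterion, CONTRAPOSITIVE under `NoExitModel'`

Context: Steer crux `stmt-ResolutionOfSingularities-16345`, card `singular-trace-constructor` (res-L0-w41-strat-1 consult 2026-08-27 (3),
the «intrinsic test the constructor search needs»).  The derivation criterion `DerivationExit.exitAt_of_derivation_isUnit`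
(`FrobeniusClosingSteerDerivationNilpotent`) read contrapositively in the vocabulary of the core datum:

* `not_isUnit_apply_of_noExitModel` — under a core datum (`CoreDatum`, only `K = Frac (k[A₀, t])` and the characteristic are used)
  and `NoExitModel'`, let `A ⊇ k` be a model inside `O` containing `t` and REGULAR at the centre, `S := locAtCentre A O`, and let
  `D` be a `k`-derivation of `K` with `D(S) ⊆ S` and `D(A₀) = 0` whose ring of constants in `S` is the centre ring of a finitely
  generated `A'' ⊇ A₀` inside `O` (`htrace`).  Then `D` VANISHES AT THE CLOSED POINT of `S`: for every NON-UNIT `y` of `S`, `D y` is a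
  non-unit of `S` (`D(𝔪_S) ⊆ 𝔪_S`).  Indeed a `y ∈ 𝔪_S` with `D y ∈ Sˣ` would make `R = locAtCentre A'' O` a regular exit stage
  (`ExitAt R p t`, and `R` regular by the `IsRsopPart` clause of `OrderOneGen`), which `NoExitModel'` forbids.
* `apply_mem_maximalIdeal_of_noExitModel` — the same conclusion spelled `D(𝔪_S) ⊆ 𝔪_S`.
-/

open IsLocalRing
open Literature.AlgebraicGeometry.Resolution
open Summit.ResolutionOfSingularities.ResolutionOfSingularities.Theorems.SteerRankThinness
open Summit.ResolutionOfSingularities.ResolutionOfSingularities.Theorems.SwitchingDichotomy.Words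

set_option linter.dupNamespace false

namespace Summit.ResolutionOfSingularities.ResolutionOfSingularities.Theorems.SwitchingDichotomy

namespace DerivationExit

/-- **The derivation criterion, contrapositive under `NoExitModel'`.**  On a model `A ∋ t` regular at the centre of `O`, a
`k`-derivation `D` of `K = Frac (k[A₀, t])` with `D(S) ⊆ S` (`S = locAtCentre A O`), `D(A₀) = 0`, whose constants in `S` form the
centre ring of a finitely generated `A'' ⊇ A₀` inside `O`, sends NON-UNITS of `S` to NON-UNITS of `S`. [folklore] -/
theorem not_isUnit_apply_of_noExitModel (p : ℕ) (hp : p.Prime)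
    (n : ℕ) (k K : Type) [Field k] [CharP k p] [Field K] [Algebra k K]
    (O : ValuationSubring K) (A₀ : Subalgebra k K) (h₀ : A₀.toSubring ≤ O.toSubring) (t : K)
    (core : CoreDatum p n k K O A₀ h₀ t) (hNE : SingularTrace.NoExitModel' p O A₀ t)
    (A : Subalgebra k K) (h : A.toSubring ≤ O.toSubring) (htA : t ∈ A)
    (hregA : IsRegularLocalRing (Localization.AtPrime (Ideal.comap (Subring.inclusion h) (maximalIdeal O))))
    (D : Derivation k K K) (hDS : ∀ s ∈ locAtCentre A.toSubring O, D s ∈ locAtCentre A.toSubring O)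
    (hDA : ∀ a ∈ A₀, D a = 0)
    (A'' : Subalgebra k K) (h'' : A''.toSubring ≤ O.toSubring) (hA₀A'' : A₀ ≤ A'') (hfgA'' : A''.FG)
    (htrace : ∀ x : K, x ∈ locAtCentre A''.toSubring O ↔ (x ∈ locAtCentre A.toSubring O ∧ D x = 0))
    {y : K} (hyS : y ∈ locAtCentre A.toSubring O) (hyu : ¬ IsUnit (⟨y, hyS⟩ : locAtCentre A.toSubring O)) :
    ¬ IsUnit (⟨D y, hDS y hyS⟩ : locAtCentre A.toSubring O) := by
  classical
  haveI : Fact p.Prime := ⟨hp⟩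
  haveI : CharP K p := charP_of_injective_algebraMap (algebraMap k K).injective p
  obtain ⟨-, htp, hfr, -⟩ := id core
  haveI instS : IsLocalRing (locAtCentre A.toSubring O) := isLocalRing_locAtCentre h
  haveI instR : IsLocalRing (locAtCentre A''.toSubring O) := isLocalRing_locAtCentre h''
  haveI hregS : IsRegularLocalRing (locAtCentre A.toSubring O) := (isRegularLocalRing_locAtCentre_iff h).mpr hregA
  intro hu
  have hym : (⟨y, hyS⟩ : locAtCentre A.toSubring O) ∈ maximalIdeal (locAtCentre A.toSubring O) := hyu
  have htS : t ∈ locAtCentre A.toSubring O := le_locAtCentre A.toSubring O htA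
  have hkS : ∀ c : k, algebraMap k K c ∈ locAtCentre A.toSubring O := fun c =>
    le_locAtCentre A.toSubring O (A.algebraMap_mem c)
  have hexit : ExitAt (locAtCentre A''.toSubring O) p t :=
    exitAt_of_derivation_isUnit p A₀ t (locAtCentre A.toSubring O) D hDS hkS hDA hyS hu
      (locAtCentre A''.toSubring O) htrace hym htS
  have hregR : IsRegularLocalRing (locAtCentre A''.toSubring O) := by
    obtain ⟨s', -, g, -, _, z, hz, -⟩ := hexit
    exact hz.1
  exact hNE A'' h'' hA₀A'' hfgA'' ((isRegularLocalRing_locAtCentre_iff h'').mp hregR) hexit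

/-- **`D(𝔪_S) ⊆ 𝔪_S` on every regular model under `NoExitModel'`** — `not_isUnit_apply_of_noExitModel` spelled with maximal ideals
(the instance `IsLocalRing (locAtCentre A O)` is `isLocalRing_locAtCentre h`). [folklore] -/
theorem apply_mem_maximalIdeal_of_noExitModel (p : ℕ) (hp : p.Prime)
    (n : ℕ) (k K : Type) [Field k] [CharP k p] [Field K] [Algebra k K]
    (O : ValuationSubring K) (A₀ : Subalgebra k K) (h₀ : A₀.toSubring ≤ O.toSubring) (t : K)
    (core : CoreDatum p n k K O A₀ h₀ t) (hNE : SingularTrace.NoExitModel' p O A₀ t)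
    (A : Subalgebra k K) (h : A.toSubring ≤ O.toSubring) (htA : t ∈ A)
    (hregA : IsRegularLocalRing (Localization.AtPrime (Ideal.comap (Subring.inclusion h) (maximalIdeal O))))
    (D : Derivation k K K) (hDS : ∀ s ∈ locAtCentre A.toSubring O, D s ∈ locAtCentre A.toSubring O)
    (hDA : ∀ a ∈ A₀, D a = 0)
    (A'' : Subalgebra k K) (h'' : A''.toSubring ≤ O.toSubring) (hA₀A'' : A₀ ≤ A'') (hfgA'' : A''.FG)
    (htrace : ∀ x : K, x ∈ locAtCentre A''.toSubring O ↔ (x ∈ locAtCentre A.toSubring O ∧ D x = 0))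
    {y : K} (hyS : y ∈ locAtCentre A.toSubring O)
    (hym : (⟨y, hyS⟩ : locAtCentre A.toSubring O) ∈
      @maximalIdeal _ _ (isLocalRing_locAtCentre h)) :
    (⟨D y, hDS y hyS⟩ : locAtCentre A.toSubring O) ∈ @maximalIdeal _ _ (isLocalRing_locAtCentre h) :=
  not_isUnit_apply_of_noExitModel p hp n k K O A₀ h₀ t core hNE A h htA hregA D hDS hDA A'' h'' hA₀A'' hfgA'' htrace hyS hym

end DerivationExit

end Summit.ResolutionOfSingularities.ResolutionOfSingularities.Theorems.SwitchingDichotomy
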